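import Summits.NavierStokesRegularity.FluidComputer.ClayBlowupZoom
import Summits.NavierStokesRegularity.FluidComputer.AlignedVorticityWeakLimit
import Literature.Analysis.FluidPDE.GigaMiura2011UnidirectionalVorticityHolds
import Literature.Analysis.FluidPDE.DirectionDissipation
import HarnessLib

/-!
# GIGA–MIURA WITH THE CLAY FORCE (viscosity `1`): a Type I Clay blow-up — WITH its Clay force —
# cannot have continuously aligned vorticity directions

Cell `ns-blowup`, seat `ns-blowup-ecbridge-2` (g10; the E–C endpoint theory seat). LABEL: E–C typing
(KERNEL — no named fact). WHAT THIS IS NOT: not Navier–Stokes evidence — a necessary condition on the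
TYPE `ClayBlowup 1` (no inhabitant is claimed anywhere). Companion memo:
`run/shared/lean/pub/ns-blowup/ecbridge2/ECBRIDGE-2-MEMO-9.md`; general viscosity and the g8-shaped
rows: `ClayBlowupForcedAlignment.lean`.

## Content

g8 typed Giga–Miura 2011 (Type I + continuous alignment (CA)/(CA′) ⇒ no blow-up) only for the
UNFORCED inhabitants of the (C) type (`not_continuousAlignment_of_typeI (hf : X.f = 0)`), and MEMO-8
listed the forced row as open «needing the forced KNSS §4 smoothing of the zooms» (the printed proof
passes the direction field to the blow-up limit through convergence OF THE VORTICITIES). THE ZOOM WITH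
FORCE (`ClayBlowup.exists_zoom_limit`) gives only `C⁰` convergence — and that is enough:
`exists_unidirectional_curl_of_tendsto_of_aligned` (`AlignedVorticityWeakLimit.lean`) transfers the
alignment to the limit through the WEAK convergence of the curls. So, for `Y : ClayBlowup 1` with ANY
Clay force:

* **`ClayBlowup.not_scaledAlignment_of_typeI_one`** — `IsTypeIBlowup Y.u Y.T` and
  `HasScaledContinuousAlignment 1 Y.T Y.u` ((CA′), Giga–Miura Remark 1.4) are incompatible. Proof:
  zoom (`exists_zoom_limit`: `W` smooth bounded ancient UNFORCED Oseen-mild on `(−∞, δ)`,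
  `‖W(0,0)‖ = 1`, zooms → `W(s)` locally uniformly); Type I passes to the limit
  (`√(−s)‖W(s,y)‖ ≤ C`, using `T − t'_j ≥ c_j²(−s)` at the slice times `t'_j = t_j + c_j² s`); (CA′)
  along the zoom slices gives `ε_j = η(θ(t'_j)·2|R|/√(−s)) → 0`-alignment above the thresholds
  `d_j = c_j² d → 0` on `B(0,R)`, so every slice `curl W(s)` is unidirectional; the tree's cores of
  Giga–Miura's Prop. 2.2 (`gigaMiura2011_unidirectional_vorticity_eq_zero_holds`: two-dimensional
  reduction + KNSS Thm 5.1 ⇒ `curl W ≡ 0`) and Prop. 2.1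
  (`gigaMiura2011_curl_not_identically_zero_of_typeI`: Type I decay + non-triviality ⇒ `curl W ≢ 0`)
  collide.

References: Y. Giga, H. Miura, Comm. Math. Phys. 303 (2011), Thm 1.1, Rem. 1.4, Props 2.1–2.2
[cite: GigaMiura2011, Thm 1.1 and §2.1]; Koch–Nadirashvili–Seregin–Šverák, Acta Math. 203 (2009),
Prop 6.1, Thm 5.1 [cite: KochNadirashviliSereginSverak2009, Prop 6.1]; C. L. Fefferman, (C)
[cite: FeffermanClay2006, (C)].
-/

noncomputable section

namespace Summit.NavierStokesRegularity.FluidComputer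

open Set MeasureTheory Filter Topology Function Metric
open scoped ENNReal NNReal InnerProductSpace RealInnerProductSpace
open Literature.Analysis Literature.Analysis.FluidPDE
open Summit.NavierStokesRegularity.NavierStokesRegularity

/-! ## §1 Small tools -/

/-- The direction field of a positively rescaled, re-parametrised vorticity is the original
direction field at the image point: `ξ[a ω ∘ g](y) = ξ[ω](g y)` for `a > 0`. [folklore] -/
theorem vorticityDirection_const_smul_comp {a : ℝ} (ha : 0 < a)
    (ω g : EuclideanSpace ℝ (Fin 3) → EuclideanSpace ℝ (Fin 3)) (y : EuclideanSpace ℝ (Fin 3)) :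
    vorticityDirection (fun z => a • ω (g z)) y = vorticityDirection ω (g y) := by
  rw [vorticityDirection_apply, vorticityDirection_apply]
  by_cases hv : ω (g y) = 0
  · simp [hv]
  · have hn : ‖ω (g y)‖ ≠ 0 := norm_ne_zero_iff.2 hv
    rw [norm_smul, Real.norm_of_nonneg ha.le, smul_smul]
    congr 1
    field_simp

/-- The vorticity direction of a zoom slice is the physical vorticity direction at the physical
point: for `w = c • stPull (c²) c t₀ x₀ u`, `ξ[curl w(s)](y) = ξ[curl u(t₀ + c²s)](x₀ + c y)`
(`curl w(s)(y) = c² curl u(…)(x₀ + c y)`, `curl_smul_stPull`). [cite: GigaMiura2011, §2.1 p. 5] -/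
theorem vorticityDirection_zoom {c : ℝ} (hc : 0 < c) (t₀ : ℝ) (x₀ : EuclideanSpace ℝ (Fin 3))
    (u : ℝ → EuclideanSpace ℝ (Fin 3) → EuclideanSpace ℝ (Fin 3)) (s : ℝ)
    (y : EuclideanSpace ℝ (Fin 3)) :
    vorticityDirection (curl ((c • stPull (c ^ 2) c t₀ x₀ u) s)) y =
      vorticityDirection (curl (u (t₀ + c ^ 2 * s))) (x₀ + c • y) := by
  have e : curl ((c • stPull (c ^ 2) c t₀ x₀ u) s) =
      fun z => (c * c) • curl (u (t₀ + c ^ 2 * s)) (x₀ + c • z) := funext fun z => curl_smul_stPull _ _ _ _ _ _ _ _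
  rw [e]
  exact vorticityDirection_const_smul_comp (mul_pos hc hc) _ (fun z => x₀ + c • z) y

namespace ClayBlowup

/-! ## §2 The near-maximum times tend to the blow-up time -/

/-- **The near-maximum times of the zoom data tend to `T`**: if `‖u(t_k, x_k)‖ ≥ k + 1` with
`t_k ∈ (0, T)`, then `t_k → T` (the velocity is bounded on every `[0, T']`, `T' < T`). [folklore] -/
theorem tendsto_of_norm_ge {ν : ℝ} (X : ClayBlowup ν) (hν : 0 < ν) {t : ℕ → ℝ}
    {x : ℕ → EuclideanSpace ℝ (Fin 3)} (ht : ∀ k, t k ∈ Ioo 0 X.T)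
    (hk1 : ∀ k : ℕ, (k : ℝ) + 1 ≤ ‖X.u (t k) (x k)‖) : Tendsto t atTop (𝓝[<] X.T) := by
  refine tendsto_nhdsWithin_iff.2 ⟨?_, Eventually.of_forall fun k => (ht k).2⟩
  refine tendsto_order.2 ⟨fun a ha => ?_, fun b hb => Eventually.of_forall fun k => (ht k).2.trans hb⟩
  -- `u` is bounded by `B` on `[0, max a 0]`, so `t_k > a` once `k + 1 > B`
  obtain ⟨B, hB⟩ := X.exists_norm_le hν (show max a 0 < X.T from max_lt ha X.T_pos)
  have hev : ∀ᶠ k : ℕ in atTop, B < (k : ℝ) + 1 :=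
    (tendsto_atTop_add_const_right _ _ tendsto_natCast_atTop_atTop).eventually (eventually_gt_atTop B)
  filter_upwards [hev] with k hk
  by_contra h
  rw [not_lt] at h
  have := hB (t k) ⟨(ht k).1.le, h.trans (le_max_left _ _)⟩ (x k)
  linarith [hk1 k]

/-! ## §3 Giga–Miura with the Clay force, viscosity `1` -/

/-- **GIGA–MIURA WITH THE CLAY FORCE (`ν = 1`; no named fact)**: for a Clay blow-up at viscosity `1`
with ANY Clay force, the Type I bound `‖u(t,x)‖ ≤ C/√(T − t)` near `T` and the scaled continuous
alignment (CA′) of the vorticity directions on `{|ω| > d}` cannot both hold. The zoom with force; Type I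
and (CA′) pass to the `C⁰` zoom limit (the latter by `exists_unidirectional_curl_of_tendsto_of_aligned`);
the tree's cores of Giga–Miura's Propositions 2.2 and 2.1 on the limit. [cite: GigaMiura2011, Thm 1.1 and §2.1]
[cite: KochNadirashviliSereginSverak2009, Prop 6.1] -/
theorem not_scaledAlignment_of_typeI_one (Y : ClayBlowup 1) (hI : IsTypeIBlowup Y.u Y.T)
    (hCA : HasScaledContinuousAlignment 1 Y.T Y.u) : False := by
  have hT := Y.T_pos
  obtain ⟨d₀, hd₀, η, θ, hηm, hηc, hη0, hθ0, hθ, hal⟩ := hCA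
  obtain ⟨C, hC⟩ := hI
  obtain ⟨t, x, c, φ, W, δ, hφ, hδ, ht, hc, hc01, hk1, hnear, -, hWc, hWdiv, hWmild, -, hW1, -,
    hknss, -, hconv⟩ := Y.exists_zoom_limit
  have hc0 : ∀ k, 0 < c k := fun k => (hc01 k).1
  have hM0 : ∀ k, 0 < ‖Y.u (t k) (x k)‖ := fun k =>
    lt_of_lt_of_le (by positivity) (hk1 k)
  have hcM : ∀ k, c k * ‖Y.u (t k) (x k)‖ = 1 := fun k => by
    rw [hc k]; exact inv_mul_cancel₀ (hM0 k).ne'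
  -- ### the slice times `t'_j(s) = t_{φ j} + c_{φ j}² s → T⁻`
  have htT : Tendsto t atTop (𝓝[<] Y.T) := Y.tendsto_of_norm_ge one_pos ht hk1
  have hcto : Tendsto c atTop (𝓝 0) := by
    have hMto : Tendsto (fun k => ‖Y.u (t k) (x k)‖) atTop atTop := by
      refine tendsto_atTop_atTop.2 fun B => ⟨⌈B⌉₊, fun k hk => ?_⟩
      have h1 : (⌈B⌉₊ : ℝ) ≤ k := by exact_mod_cast hk
      linarith [Nat.le_ceil B, hk1 k]
    exact (tendsto_inv_atTop_zero.comp hMto).congr fun k => by simp [Function.comp, hc k]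
  have htime : ∀ s ≤ 0, Tendsto (fun j => t (φ j) + c (φ j) ^ 2 * s) atTop (𝓝[<] Y.T) := by
    intro s hs
    have h1 : Tendsto (fun j => t (φ j)) atTop (𝓝 Y.T) :=
      (tendsto_nhdsWithin_iff.1 htT).1.comp hφ.tendsto_atTop
    have h2 : Tendsto (fun j => c (φ j) ^ 2 * s) atTop (𝓝 0) := by
      simpa using ((hcto.comp hφ.tendsto_atTop).pow 2).mul_const s
    refine tendsto_nhdsWithin_iff.2 ⟨by simpa using h1.add h2, Eventually.of_forall fun j => ?_⟩
    have : c (φ j) ^ 2 * s ≤ 0 := mul_nonpos_of_nonneg_of_nonpos (sq_nonneg _) hs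
    exact lt_of_le_of_lt (by linarith) (ht (φ j)).2
  -- eventually the slice time lies in `(0, t_{φ j}]` and the Type I bound holds there
  have hmem : ∀ s ≤ 0, ∀ᶠ j in atTop, t (φ j) + c (φ j) ^ 2 * s ∈ Ioc 0 (t (φ j)) := by
    intro s hs
    filter_upwards [(htime s hs).eventually (Ioo_mem_nhdsLT hT)] with j hj
    have : c (φ j) ^ 2 * s ≤ 0 := mul_nonpos_of_nonneg_of_nonpos (sq_nonneg _) hs
    exact ⟨hj.1, by linarith⟩
  -- `T − t' ≥ c² (−s)`, in square-root form: `c √(−s) ≤ √(1·(T − t'))`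
  have hsqrt : ∀ s ≤ 0, ∀ j, c (φ j) * Real.sqrt (-s) ≤
      Real.sqrt (1 * (Y.T - (t (φ j) + c (φ j) ^ 2 * s))) := by
    intro s hs j
    have e1 : c (φ j) * Real.sqrt (-s) = Real.sqrt (c (φ j) ^ 2 * -s) := by
      rw [Real.sqrt_mul (sq_nonneg _), Real.sqrt_sq (hc0 _).le]
    rw [e1]
    refine Real.sqrt_le_sqrt ?_
    have e2 : c (φ j) ^ 2 * -s = -(c (φ j) ^ 2 * s) := by ring
    rw [e2, one_mul]
    linarith [(ht (φ j)).2]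
  -- ### the limit on `(−∞, 0)`: smooth, bounded, Oseen-mild
  have hWc0 : ContinuousOn (uncurry W) (Iio 0 ×ˢ univ) :=
    hWc.mono (prod_mono (fun s hs => lt_trans hs hδ) subset_rfl)
  have hWdiv0 : ∀ s < 0, IsWeaklyDivFree (W s) := fun s hs => hWdiv s (hs.trans hδ)
  have hWmild0 : ∀ s τ : ℝ, s < τ → τ < 0 → ∀ y,
      W τ y = UnboundedOperators.heatExtension (W s) (τ - s) y - oseenDuhamel 1 s W W τ y :=
    fun s τ hsτ hτ y => hWmild s τ hsτ (hτ.trans hδ) y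
  have hWbd0 : ∀ s < 0, ∀ y, ‖W s y‖ ≤ 1 := fun s hs y => hW1 s hs.le y
  obtain ⟨hsm, hder⟩ := smooth_and_bounds_of_bounded_ancient_oseenMild hWc0 hWdiv0 hWmild0 hWbd0
  have hslice : ∀ s < 0, ContDiff ℝ (⊤ : ℕ∞) (W s) := fun s hs =>
    hsm.comp_contDiff (contDiff_prodMk_right s) fun y => mk_mem_prod (mem_Iio.2 hs) (mem_univ y)
  -- pointwise convergence of the zoom slices at `s < 0`
  have hpt : ∀ s < 0, ∀ y, Tendsto
      (fun j => (c (φ j) • stPull (c (φ j) ^ 2) (c (φ j)) (t (φ j)) (x (φ j)) Y.u) s y) atTop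
      (𝓝 (W s y)) := fun s hs y =>
    ((hconv s (hs.trans hδ)).tendstoLocallyUniformlyOn (s := univ)).tendsto_at (mem_univ y)
  -- ### (1) Type I passes to the limit
  have hIW : ∀ s < 0, ∀ y, Real.sqrt (-s) * ‖W s y‖ ≤ C := by
    intro s hs y
    have hs0 : 0 < Real.sqrt (-s) := Real.sqrt_pos.2 (by linarith)
    refine le_of_tendsto ((hpt s hs y).norm.const_mul _) ?_
    filter_upwards [(htime s hs.le).eventually hC, hmem s hs.le] with j hj hjm
    rw [smul_stPull_apply, norm_smul, Real.norm_of_nonneg (hc0 _).le]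
    have h1 := hj (x (φ j) + c (φ j) • y)
    have h2 := hsqrt s hs.le j
    rw [one_mul] at h2
    have hTt : 0 < Real.sqrt (Y.T - (t (φ j) + c (φ j) ^ 2 * s)) :=
      lt_of_lt_of_le (mul_pos (hc0 _) hs0) h2
    have hC0 : 0 ≤ C := by
      have h0 := (norm_nonneg _).trans h1
      exact (div_nonneg_iff.1 h0).elim (fun h => h.1) fun h => absurd h.2 (not_le.2 hTt)
    have hcφ : 0 ≤ c (φ j) := (hc0 _).le
    -- `√(−s) · c · ‖u‖ ≤ √(−s) c C/√(T − t') ≤ C`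
    calc Real.sqrt (-s) * (c (φ j) * ‖Y.u (t (φ j) + c (φ j) ^ 2 * s) (x (φ j) + c (φ j) • y)‖)
        ≤ Real.sqrt (-s) * (c (φ j) * (C / Real.sqrt (Y.T - (t (φ j) + c (φ j) ^ 2 * s)))) := by
          gcongr
      _ = C * (c (φ j) * Real.sqrt (-s) / Real.sqrt (Y.T - (t (φ j) + c (φ j) ^ 2 * s))) := by
          ring
      _ ≤ C * 1 := by
          gcongr
          rw [div_le_one hTt]; exact h2
      _ = C := mul_one C
  -- ### (2) the limit is non-trivial before the vertex
  have hnt : ∃ s < 0, ∃ y, W s y ≠ 0 := by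
    obtain ⟨s, hs, y, hy⟩ := hknss.exists_lt_norm (1 / 2) (by norm_num)
    exact ⟨s, hs, y, fun h => by rw [h, norm_zero] at hy; linarith⟩
  -- ### (3) every slice of the limit has unidirectional vorticity
  have hdir : ∀ s < 0, ∃ ζ : EuclideanSpace ℝ (Fin 3), ∀ y, curl (W s) y = ‖curl (W s) y‖ • ζ := by
    intro s hs
    have hs0 : 0 < Real.sqrt (-s) := Real.sqrt_pos.2 (by linarith)
    refine exists_unidirectional_curl_of_tendsto_of_aligned (K := 2)
      (w := fun j => (c (φ j) • stPull (c (φ j) ^ 2) (c (φ j)) (t (φ j)) (x (φ j)) Y.u) s)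
      ?_ ((hslice s hs).of_le (by norm_cast)) (by norm_num) ?_ (hpt s hs) fun R => ?_
    · -- the zoom slices are `C¹`, eventually
      filter_upwards [hmem s hs.le] with j hj
      have htI : t (φ j) + c (φ j) ^ 2 * s ∈ Ico 0 Y.T := ⟨hj.1.le, hj.2.trans_lt (ht (φ j)).2⟩
      have hcd := Y.classical.contDiff_velocity htI
      have e : (c (φ j) • stPull (c (φ j) ^ 2) (c (φ j)) (t (φ j)) (x (φ j)) Y.u) s =
          fun y => c (φ j) • Y.u (t (φ j) + c (φ j) ^ 2 * s) (x (φ j) + c (φ j) • y) := rfl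
      rw [e]
      have haff : ContDiff ℝ 1 (fun y : EuclideanSpace ℝ (Fin 3) => x (φ j) + c (φ j) • y) :=
        contDiff_const.add (contDiff_id.const_smul (c (φ j)))
      have h1 : ContDiff ℝ 1 (Y.u (t (φ j) + c (φ j) ^ 2 * s)) := hcd.of_le (by norm_cast)
      exact (h1.comp haff).const_smul (c (φ j))
    · -- bounded by `2`, eventually
      filter_upwards [hmem s hs.le] with j hj y
      rw [smul_stPull_apply, norm_smul, Real.norm_of_nonneg (hc0 _).le]
      have h := hnear (φ j) _ hj (x (φ j) + c (φ j) • y)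
      have h1 : (1 + 1 / (((φ j : ℕ) : ℝ) + 1)) ≤ 2 := by
        have : 1 / (((φ j : ℕ) : ℝ) + 1) ≤ 1 := (div_le_one (by positivity)).2 (by linarith [(φ j).cast_nonneg (α := ℝ)])
        linarith
      calc c (φ j) * ‖Y.u (t (φ j) + c (φ j) ^ 2 * s) (x (φ j) + c (φ j) • y)‖
          ≤ c (φ j) * ((1 + 1 / (((φ j : ℕ) : ℝ) + 1)) * ‖Y.u (t (φ j)) (x (φ j))‖) :=
            mul_le_mul_of_nonneg_left h (hc0 _).le
        _ = 1 + 1 / (((φ j : ℕ) : ℝ) + 1) := by rw [← mul_assoc, mul_comm (c (φ j)), mul_assoc, hcM, mul_one]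
        _ ≤ 2 := h1
    · -- (CA′) along the zoom slices on the ball `B(0, R)`
      set arg : ℕ → ℝ := fun j => θ (t (φ j) + c (φ j) ^ 2 * s) * (2 * |R|) / Real.sqrt (-s)
        with harg
      have harg0 : ∀ j, 0 ≤ arg j := fun j =>
        div_nonneg (mul_nonneg (hθ0 _) (by positivity)) (Real.sqrt_nonneg _)
      have harglim : Tendsto arg atTop (𝓝 0) := by
        have h1 : Tendsto (fun j => θ (t (φ j) + c (φ j) ^ 2 * s)) atTop (𝓝 0) :=
          hθ.comp (htime s hs.le)
        simpa [harg] using (h1.mul_const (2 * |R|)).div_const (Real.sqrt (-s))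
      have hε0 : ∀ j, 0 ≤ η (arg j) := fun j => by
        rw [← hη0]; exact hηm self_mem_Ici (harg0 j) (harg0 j)
      have hεlim : Tendsto (fun j => η (arg j)) atTop (𝓝 0) := by
        rw [← hη0]
        exact (hηc.continuousWithinAt self_mem_Ici).tendsto.comp
          (tendsto_nhdsWithin_iff.2 ⟨harglim, Eventually.of_forall harg0⟩)
      have hdlim : Tendsto (fun j => c (φ j) ^ 2 * d₀) atTop (𝓝 0) := by
        simpa using ((hcto.comp hφ.tendsto_atTop).pow 2).mul_const d₀
      refine ⟨fun j => η (arg j), fun j => c (φ j) ^ 2 * d₀, hεlim, hdlim, hε0,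
        fun j => by positivity, ?_⟩
      filter_upwards [hmem s hs.le] with j hj y hy y' hy' hdy hdy'
      set k := φ j with hk
      set t' : ℝ := t k + c k ^ 2 * s with ht'
      have ht'I : t' ∈ Ioo 0 Y.T := ⟨hj.1, hj.2.trans_lt (ht k).2⟩
      -- physical vorticities above `d₀`
      have hcurl : ∀ z : EuclideanSpace ℝ (Fin 3),
          ‖curl ((c k • stPull (c k ^ 2) (c k) (t k) (x k) Y.u) s) z‖ =
            c k * c k * ‖curl (Y.u t') (x k + c k • z)‖ := fun z => by
        rw [curl_smul_stPull, norm_smul, Real.norm_of_nonneg (mul_self_nonneg _)]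
      have hcc : 0 < c k * c k := mul_pos (hc0 k) (hc0 k)
      have hd1 : d₀ < ‖curl (Y.u t') (x k + c k • y)‖ := by
        rw [hcurl, sq] at hdy; exact lt_of_mul_lt_mul_left (by linarith) hcc.le
      have hd2 : d₀ < ‖curl (Y.u t') (x k + c k • y')‖ := by
        rw [hcurl, sq] at hdy'; exact lt_of_mul_lt_mul_left (by linarith) hcc.le
      rw [vorticityDirection_zoom (hc0 k), vorticityDirection_zoom (hc0 k)]
      refine (hal t' ht'I _ _ hd1 hd2).trans (hηm ?_ (harg0 j) ?_)
      · exact mem_Ici.2 (div_nonneg (mul_nonneg (hθ0 _) (norm_nonneg _)) (Real.sqrt_nonneg _))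
      · -- `θ(t') · c‖y − y'‖/√(T − t') ≤ θ(t') · 2|R|/√(−s)`
        have hyy : ‖(x k + c k • y) - (x k + c k • y')‖ = c k * ‖y - y'‖ := by
          rw [add_sub_add_left_eq_sub, ← smul_sub, norm_smul, Real.norm_of_nonneg (hc0 k).le]
        have hdist : ‖y - y'‖ ≤ 2 * |R| := by
          rw [mem_ball_zero_iff] at hy hy'
          calc ‖y - y'‖ ≤ ‖y‖ + ‖y'‖ := norm_sub_le _ _
            _ ≤ 2 * |R| := by linarith [le_abs_self R]
        have h2 := hsqrt s hs.le j
        have hck : 0 ≤ c k * Real.sqrt (-s) := (mul_pos (hc0 k) hs0).le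
        have hTt : 0 < Real.sqrt (1 * (Y.T - t')) := lt_of_lt_of_le (mul_pos (hc0 k) hs0) h2
        rw [hyy, harg]
        show θ t' * (c k * ‖y - y'‖) / Real.sqrt (1 * (Y.T - t')) ≤
          θ (t (φ j) + c (φ j) ^ 2 * s) * (2 * |R|) / Real.sqrt (-s)
        rw [← ht', div_le_div_iff₀ hTt hs0]
        have hθt : 0 ≤ θ t' := hθ0 t'
        calc θ t' * (c k * ‖y - y'‖) * Real.sqrt (-s)
            = θ t' * ‖y - y'‖ * (c k * Real.sqrt (-s)) := by ring
          _ ≤ θ t' * (2 * |R|) * Real.sqrt (1 * (Y.T - t')) := by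
              gcongr
  -- ### (4) Giga–Miura's Propositions 2.2 and 2.1 on the limit collide
  let ζ₀ : ℝ → EuclideanSpace ℝ (Fin 3) := fun s => if h : s < 0 then Classical.choose (hdir s h) else 0
  have hζ₀ : ∀ s < 0, ∀ y, curl (W s) y = ‖curl (W s) y‖ • ζ₀ s := by
    intro s hs y
    simp only [ζ₀, dif_pos hs]
    exact Classical.choose_spec (hdir s hs) y
  have hzero : ∀ s < 0, ∀ y, curl (W s) y = 0 :=
    gigaMiura2011_unidirectional_vorticity_eq_zero_holds hsm hder hWdiv0 hWmild0 ⟨ζ₀, hζ₀⟩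
  exact gigaMiura2011_curl_not_identically_zero_of_typeI (C₀ := C)
    (fun s hs => (hslice s hs).of_le (by norm_cast)) ⟨1, hWbd0⟩ hWdiv0 hWmild0 hnt hIW hzero

end ClayBlowup

end Summit.NavierStokesRegularity.FluidComputer

end
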